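import Summits.CriticalPhenomena.PercolationContinuityZ3.Theorems.PercNearOneGluingNoHeavyLowerTailStarKit
import Summits.CriticalPhenomena.PercolationContinuityZ3.Theorems.PercNearOneGluingNoHeavyLowerTailSourceRepellerExchange
import HarnessLib

/-!
# `NoHeavyLowerTail` (stmt-CriticalPhenomena-4575) — (Y13) for two-hair observers

Route `PercNearOneGluingNoHeavy`, crux `NoHeavyLowerTail`; registered stub `stub_sourceRepellerExchangeThreeRelays`
(= (Y13), the hypothesis of `preFKG3_of_stubSourceRepellerExchange`):
`μ(N₂ ∩ {a₂↔o})·(J₁g₃ − J₃g₁) ≤ μ(N₂)·(G₁g₃ − G₃g₁)`.  This file proves it for every finite weighted graph in which the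
observer `o` carries positive weight only on the pairs `{o,a₁}`, `{o,a₂}` (`y13_twoHair`, the stub's shape plus the
isolation hypothesis), and deduces Kozma–Nitzan's Question 7 at `|A| = 3` for these instances (`preFKG3_twoHair`).
Method: slice the eight measures along the star events `σ_B`, `B ⊆ {a₁,a₂}` (`th_exp_*`: each is affine in the four
star weights with coefficients measured in `G ∖ o`); the difference of the two sides is then *identically*
`μ'(N₂)·s_{12}·(s_∅+s₁+s₂)·s_∅·Z₀` with `Z₀ = μ'(N₁₂∩(B₁∪B₂))μ'(R∩T) − μ'(N₁₂∩T)μ'(R∩B) ≥ 0` (`th_Z0_nonneg`,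
one BHK exchange row).  General observers (the stub itself) remain open; see the item's evidence `RESIDUAL-gen9.md`.
-/

namespace Summit.CriticalPhenomena.PercolationContinuityZ3.Theorems

open MeasureTheory Set Literature.Probability.LatticeModels Literature.Probability.Percolation
open Literature.Probability.Percolation.KNPreFKG

noncomputable section

open Classical

section Slices

variable {V : Type*} [Fintype V] (w : Sym2 V → unitInterval) (o : V) (a₁ a₂ a₃ b : ({o}ᶜ : Set V))

/-- **Slices of `g₁ = μ(R ∩ {a₁↔b})`, `R = {a₁↮a₃}`.** [cite: KozmaNitzan2024, proof of Thm. 4 (pp. 13–14)] -/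
theorem th_exp_g1 (h12 : (a₁ : V) ≠ a₂)
    (hiso : ∀ u, u ≠ o → u ∉ ({(a₁ : V), (a₂ : V)} : Finset V) → w s(o, u) = 0) :
    (prodBernoulli w).real ((openConn (a₁ : V) (a₃ : V))ᶜ ∩ openConn (a₁ : V) (b : V)) =
      (prodBernoulli w).real (starEvent o (∅ : Set V)) *
        (prodBernoulli (w ∘ Sym2.map (Subtype.val : ({o}ᶜ : Set V) → V))).real ((openConn a₁ a₃)ᶜ ∩ openConn a₁ b) +
      (prodBernoulli w).real (starEvent o ({(a₁ : V)} : Set V)) *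
        (prodBernoulli (w ∘ Sym2.map (Subtype.val : ({o}ᶜ : Set V) → V))).real ((openConn a₁ a₃)ᶜ ∩ openConn a₁ b) +
      (prodBernoulli w).real (starEvent o ({(a₂ : V)} : Set V)) *
        (prodBernoulli (w ∘ Sym2.map (Subtype.val : ({o}ᶜ : Set V) → V))).real ((openConn a₁ a₃)ᶜ ∩ openConn a₁ b) +
      (prodBernoulli w).real (starEvent o ({(a₁ : V), (a₂ : V)} : Set V)) *
        (prodBernoulli (w ∘ Sym2.map (Subtype.val : ({o}ᶜ : Set V) → V))).real ((openConn a₁ a₃)ᶜ ∩ (openConn a₃ a₂)ᶜ ∩ (openConn a₁ b ∪ openConn a₂ b)) := by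
  have h1o : (a₁ : V) ≠ o := a₁.2
  have h2o : (a₂ : V) ≠ o := a₂.2
  have h3o : (a₃ : V) ≠ o := a₃.2
  have hbo : (b : V) ≠ o := b.2
  rw [th_real_eq_four w h12 h1o.symm h2o.symm hiso]
  rw [th_real_inter_star w o ∅ (E' := (openConn a₁ a₃)ᶜ ∩ openConn a₁ b) fun ω hσ => by
        simp only [Set.mem_inter_iff, Set.mem_compl_iff, th_kit_pre, th_kit_empty hσ h1o h3o, th_kit_empty hσ h1o hbo],
    th_real_inter_star w o {(a₁ : V)} (E' := (openConn a₁ a₃)ᶜ ∩ openConn a₁ b) fun ω hσ => by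
        simp only [Set.mem_inter_iff, Set.mem_compl_iff, th_kit_pre, th_kit_single hσ h1o h3o, th_kit_single hσ h1o hbo],
    th_real_inter_star w o {(a₂ : V)} (E' := (openConn a₁ a₃)ᶜ ∩ openConn a₁ b) fun ω hσ => by
        simp only [Set.mem_inter_iff, Set.mem_compl_iff, th_kit_pre, th_kit_single hσ h1o h3o, th_kit_single hσ h1o hbo],
    th_real_inter_star w o {(a₁ : V), (a₂ : V)} (E' := (openConn a₁ a₃)ᶜ ∩ (openConn a₃ a₂)ᶜ ∩ (openConn a₁ b ∪ openConn a₂ b)) fun ω hσ => by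
        simp only [Set.mem_inter_iff, Set.mem_compl_iff, th_kit_pre, Set.mem_union, th_kit_pair hσ h1o h2o h1o h3o,
          th_kit_pair hσ h1o h2o h1o hbo,
          th_off_rfl h1o ω, true_or, true_and, th_off_comm {o}ᶜ (a₃ : V) (a₂ : V) ω]
        tauto]

/-- **Slices of `g₃ = μ(R ∩ {a₃↔b})`.** [cite: KozmaNitzan2024, proof of Thm. 4 (pp. 13–14)] -/
theorem th_exp_g3 (h12 : (a₁ : V) ≠ a₂)
    (hiso : ∀ u, u ≠ o → u ∉ ({(a₁ : V), (a₂ : V)} : Finset V) → w s(o, u) = 0) :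
    (prodBernoulli w).real ((openConn (a₁ : V) (a₃ : V))ᶜ ∩ openConn (a₃ : V) (b : V)) =
      (prodBernoulli w).real (starEvent o (∅ : Set V)) *
        (prodBernoulli (w ∘ Sym2.map (Subtype.val : ({o}ᶜ : Set V) → V))).real ((openConn a₁ a₃)ᶜ ∩ openConn a₃ b) +
      (prodBernoulli w).real (starEvent o ({(a₁ : V)} : Set V)) *
        (prodBernoulli (w ∘ Sym2.map (Subtype.val : ({o}ᶜ : Set V) → V))).real ((openConn a₁ a₃)ᶜ ∩ openConn a₃ b) +
      (prodBernoulli w).real (starEvent o ({(a₂ : V)} : Set V)) *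
        (prodBernoulli (w ∘ Sym2.map (Subtype.val : ({o}ᶜ : Set V) → V))).real ((openConn a₁ a₃)ᶜ ∩ openConn a₃ b) +
      (prodBernoulli w).real (starEvent o ({(a₁ : V), (a₂ : V)} : Set V)) *
        (prodBernoulli (w ∘ Sym2.map (Subtype.val : ({o}ᶜ : Set V) → V))).real ((openConn a₁ a₃)ᶜ ∩ (openConn a₃ a₂)ᶜ ∩ openConn a₃ b) := by
  have h1o : (a₁ : V) ≠ o := a₁.2
  have h2o : (a₂ : V) ≠ o := a₂.2
  have h3o : (a₃ : V) ≠ o := a₃.2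
  have hbo : (b : V) ≠ o := b.2
  rw [th_real_eq_four w h12 h1o.symm h2o.symm hiso]
  rw [th_real_inter_star w o ∅ (E' := (openConn a₁ a₃)ᶜ ∩ openConn a₃ b) fun ω hσ => by
        simp only [Set.mem_inter_iff, Set.mem_compl_iff, th_kit_pre, th_kit_empty hσ h1o h3o, th_kit_empty hσ h3o hbo],
    th_real_inter_star w o {(a₁ : V)} (E' := (openConn a₁ a₃)ᶜ ∩ openConn a₃ b) fun ω hσ => by
        simp only [Set.mem_inter_iff, Set.mem_compl_iff, th_kit_pre, th_kit_single hσ h1o h3o, th_kit_single hσ h3o hbo],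
    th_real_inter_star w o {(a₂ : V)} (E' := (openConn a₁ a₃)ᶜ ∩ openConn a₃ b) fun ω hσ => by
        simp only [Set.mem_inter_iff, Set.mem_compl_iff, th_kit_pre, th_kit_single hσ h1o h3o, th_kit_single hσ h3o hbo],
    th_real_inter_star w o {(a₁ : V), (a₂ : V)} (E' := (openConn a₁ a₃)ᶜ ∩ (openConn a₃ a₂)ᶜ ∩ openConn a₃ b) fun ω hσ => by
        simp only [Set.mem_inter_iff, Set.mem_compl_iff, th_kit_pre, th_kit_pair hσ h1o h2o h1o h3o,
          th_kit_pair hσ h1o h2o h3o hbo,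
          th_off_rfl h1o ω, true_or, true_and, th_off_comm {o}ᶜ (a₃ : V) (a₂ : V) ω, th_off_comm {o}ᶜ (a₃ : V) (a₁ : V) ω]
        tauto]

/-- **Slices of `J₁ = μ(R ∩ {a₁↔a₂} ∩ {a₁↔b})`.** [cite: KozmaNitzan2024, proof of Thm. 4 (pp. 13–14)] -/
theorem th_exp_J1 (h12 : (a₁ : V) ≠ a₂)
    (hiso : ∀ u, u ≠ o → u ∉ ({(a₁ : V), (a₂ : V)} : Finset V) → w s(o, u) = 0) :
    (prodBernoulli w).real ((openConn (a₁ : V) (a₃ : V))ᶜ ∩ (openConn (a₁ : V) (a₂ : V) ∩ openConn (a₁ : V) (b : V))) =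
      (prodBernoulli w).real (starEvent o (∅ : Set V)) *
        (prodBernoulli (w ∘ Sym2.map (Subtype.val : ({o}ᶜ : Set V) → V))).real ((openConn a₁ a₃)ᶜ ∩ (openConn a₁ a₂ ∩ openConn a₁ b)) +
      (prodBernoulli w).real (starEvent o ({(a₁ : V)} : Set V)) *
        (prodBernoulli (w ∘ Sym2.map (Subtype.val : ({o}ᶜ : Set V) → V))).real ((openConn a₁ a₃)ᶜ ∩ (openConn a₁ a₂ ∩ openConn a₁ b)) +
      (prodBernoulli w).real (starEvent o ({(a₂ : V)} : Set V)) *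
        (prodBernoulli (w ∘ Sym2.map (Subtype.val : ({o}ᶜ : Set V) → V))).real ((openConn a₁ a₃)ᶜ ∩ (openConn a₁ a₂ ∩ openConn a₁ b)) +
      (prodBernoulli w).real (starEvent o ({(a₁ : V), (a₂ : V)} : Set V)) *
        (prodBernoulli (w ∘ Sym2.map (Subtype.val : ({o}ᶜ : Set V) → V))).real ((openConn a₁ a₃)ᶜ ∩ (openConn a₃ a₂)ᶜ ∩ (openConn a₁ b ∪ openConn a₂ b)) := by
  have h1o : (a₁ : V) ≠ o := a₁.2
  have h2o : (a₂ : V) ≠ o := a₂.2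
  have h3o : (a₃ : V) ≠ o := a₃.2
  have hbo : (b : V) ≠ o := b.2
  rw [th_real_eq_four w h12 h1o.symm h2o.symm hiso]
  rw [th_real_inter_star w o ∅ (E' := (openConn a₁ a₃)ᶜ ∩ (openConn a₁ a₂ ∩ openConn a₁ b)) fun ω hσ => by
        simp only [Set.mem_inter_iff, Set.mem_compl_iff, th_kit_pre, th_kit_empty hσ h1o h3o, th_kit_empty hσ h1o h2o, th_kit_empty hσ h1o hbo],
    th_real_inter_star w o {(a₁ : V)} (E' := (openConn a₁ a₃)ᶜ ∩ (openConn a₁ a₂ ∩ openConn a₁ b)) fun ω hσ => by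
        simp only [Set.mem_inter_iff, Set.mem_compl_iff, th_kit_pre, th_kit_single hσ h1o h3o, th_kit_single hσ h1o h2o, th_kit_single hσ h1o hbo],
    th_real_inter_star w o {(a₂ : V)} (E' := (openConn a₁ a₃)ᶜ ∩ (openConn a₁ a₂ ∩ openConn a₁ b)) fun ω hσ => by
        simp only [Set.mem_inter_iff, Set.mem_compl_iff, th_kit_pre, th_kit_single hσ h1o h3o, th_kit_single hσ h1o h2o, th_kit_single hσ h1o hbo],
    th_real_inter_star w o {(a₁ : V), (a₂ : V)} (E' := (openConn a₁ a₃)ᶜ ∩ (openConn a₃ a₂)ᶜ ∩ (openConn a₁ b ∪ openConn a₂ b)) fun ω hσ => by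
        simp only [Set.mem_inter_iff, Set.mem_compl_iff, th_kit_pre, Set.mem_union, th_kit_pair hσ h1o h2o h1o h3o,
          th_kit_pair hσ h1o h2o h1o h2o,
          th_kit_pair hσ h1o h2o h1o hbo,
          th_off_rfl h1o ω, th_off_rfl h2o ω, true_or, or_true, true_and, and_true, th_off_comm {o}ᶜ (a₃ : V) (a₂ : V) ω]
        tauto]

/-- **Slices of `J₃ = μ(R ∩ {a₁↔a₂} ∩ {a₃↔b})`.** [cite: KozmaNitzan2024, proof of Thm. 4 (pp. 13–14)] -/
theorem th_exp_J3 (h12 : (a₁ : V) ≠ a₂)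
    (hiso : ∀ u, u ≠ o → u ∉ ({(a₁ : V), (a₂ : V)} : Finset V) → w s(o, u) = 0) :
    (prodBernoulli w).real ((openConn (a₁ : V) (a₃ : V))ᶜ ∩ (openConn (a₁ : V) (a₂ : V) ∩ openConn (a₃ : V) (b : V))) =
      (prodBernoulli w).real (starEvent o (∅ : Set V)) *
        (prodBernoulli (w ∘ Sym2.map (Subtype.val : ({o}ᶜ : Set V) → V))).real ((openConn a₁ a₃)ᶜ ∩ (openConn a₁ a₂ ∩ openConn a₃ b)) +
      (prodBernoulli w).real (starEvent o ({(a₁ : V)} : Set V)) *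
        (prodBernoulli (w ∘ Sym2.map (Subtype.val : ({o}ᶜ : Set V) → V))).real ((openConn a₁ a₃)ᶜ ∩ (openConn a₁ a₂ ∩ openConn a₃ b)) +
      (prodBernoulli w).real (starEvent o ({(a₂ : V)} : Set V)) *
        (prodBernoulli (w ∘ Sym2.map (Subtype.val : ({o}ᶜ : Set V) → V))).real ((openConn a₁ a₃)ᶜ ∩ (openConn a₁ a₂ ∩ openConn a₃ b)) +
      (prodBernoulli w).real (starEvent o ({(a₁ : V), (a₂ : V)} : Set V)) *
        (prodBernoulli (w ∘ Sym2.map (Subtype.val : ({o}ᶜ : Set V) → V))).real ((openConn a₁ a₃)ᶜ ∩ (openConn a₃ a₂)ᶜ ∩ openConn a₃ b) := by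
  have h1o : (a₁ : V) ≠ o := a₁.2
  have h2o : (a₂ : V) ≠ o := a₂.2
  have h3o : (a₃ : V) ≠ o := a₃.2
  have hbo : (b : V) ≠ o := b.2
  rw [th_real_eq_four w h12 h1o.symm h2o.symm hiso]
  rw [th_real_inter_star w o ∅ (E' := (openConn a₁ a₃)ᶜ ∩ (openConn a₁ a₂ ∩ openConn a₃ b)) fun ω hσ => by
        simp only [Set.mem_inter_iff, Set.mem_compl_iff, th_kit_pre, th_kit_empty hσ h1o h3o, th_kit_empty hσ h1o h2o, th_kit_empty hσ h3o hbo],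
    th_real_inter_star w o {(a₁ : V)} (E' := (openConn a₁ a₃)ᶜ ∩ (openConn a₁ a₂ ∩ openConn a₃ b)) fun ω hσ => by
        simp only [Set.mem_inter_iff, Set.mem_compl_iff, th_kit_pre, th_kit_single hσ h1o h3o, th_kit_single hσ h1o h2o, th_kit_single hσ h3o hbo],
    th_real_inter_star w o {(a₂ : V)} (E' := (openConn a₁ a₃)ᶜ ∩ (openConn a₁ a₂ ∩ openConn a₃ b)) fun ω hσ => by
        simp only [Set.mem_inter_iff, Set.mem_compl_iff, th_kit_pre, th_kit_single hσ h1o h3o, th_kit_single hσ h1o h2o, th_kit_single hσ h3o hbo],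
    th_real_inter_star w o {(a₁ : V), (a₂ : V)} (E' := (openConn a₁ a₃)ᶜ ∩ (openConn a₃ a₂)ᶜ ∩ openConn a₃ b) fun ω hσ => by
        simp only [Set.mem_inter_iff, Set.mem_compl_iff, th_kit_pre, th_kit_pair hσ h1o h2o h1o h3o,
          th_kit_pair hσ h1o h2o h1o h2o,
          th_kit_pair hσ h1o h2o h3o hbo,
          th_off_rfl h1o ω, th_off_rfl h2o ω, true_or, or_true, true_and, and_true, th_off_comm {o}ᶜ (a₃ : V) (a₂ : V) ω, th_off_comm {o}ᶜ (a₃ : V) (a₁ : V) ω]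
        tauto]

/-- **Slices of `G₁ = μ(R ∩ {a₁↔o} ∩ {a₁↔b})`** (the `σ_∅` slice vanishes). [cite: KozmaNitzan2024, proof of Thm. 4 (pp. 13–14)] -/
theorem th_exp_G1 (h12 : (a₁ : V) ≠ a₂)
    (hiso : ∀ u, u ≠ o → u ∉ ({(a₁ : V), (a₂ : V)} : Finset V) → w s(o, u) = 0) :
    (prodBernoulli w).real ((openConn (a₁ : V) (a₃ : V))ᶜ ∩ (openConn (a₁ : V) o ∩ openConn (a₁ : V) (b : V))) =
      (prodBernoulli w).real (starEvent o ({(a₁ : V)} : Set V)) *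
        (prodBernoulli (w ∘ Sym2.map (Subtype.val : ({o}ᶜ : Set V) → V))).real ((openConn a₁ a₃)ᶜ ∩ openConn a₁ b) +
      (prodBernoulli w).real (starEvent o ({(a₂ : V)} : Set V)) *
        (prodBernoulli (w ∘ Sym2.map (Subtype.val : ({o}ᶜ : Set V) → V))).real ((openConn a₁ a₃)ᶜ ∩ (openConn a₂ a₁ ∩ openConn a₁ b)) +
      (prodBernoulli w).real (starEvent o ({(a₁ : V), (a₂ : V)} : Set V)) *
        (prodBernoulli (w ∘ Sym2.map (Subtype.val : ({o}ᶜ : Set V) → V))).real ((openConn a₁ a₃)ᶜ ∩ (openConn a₃ a₂)ᶜ ∩ (openConn a₁ b ∪ openConn a₂ b)) := by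
  have h1o : (a₁ : V) ≠ o := a₁.2
  have h2o : (a₂ : V) ≠ o := a₂.2
  have h3o : (a₃ : V) ≠ o := a₃.2
  have hbo : (b : V) ≠ o := b.2
  rw [th_real_eq_four w h12 h1o.symm h2o.symm hiso]
  rw [th_real_inter_star_zero w o ∅ fun ω hσ hE => by
        exact th_kit_empty_o hσ h1o hE.2.1,
    th_real_inter_star w o {(a₁ : V)} (E' := (openConn a₁ a₃)ᶜ ∩ openConn a₁ b) fun ω hσ => by
        simp only [Set.mem_inter_iff, Set.mem_compl_iff, th_kit_pre, th_kit_single hσ h1o h3o, th_kit_single hσ h1o hbo, th_kit_single_o hσ h1o h1o, th_off_rfl h1o ω, true_and],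
    th_real_inter_star w o {(a₂ : V)} (E' := (openConn a₁ a₃)ᶜ ∩ (openConn a₂ a₁ ∩ openConn a₁ b)) fun ω hσ => by
        simp only [Set.mem_inter_iff, Set.mem_compl_iff, th_kit_pre, th_kit_single hσ h1o h3o, th_kit_single hσ h1o hbo, th_kit_single_o hσ h2o h1o],
    th_real_inter_star w o {(a₁ : V), (a₂ : V)} (E' := (openConn a₁ a₃)ᶜ ∩ (openConn a₃ a₂)ᶜ ∩ (openConn a₁ b ∪ openConn a₂ b)) fun ω hσ => by
        simp only [Set.mem_inter_iff, Set.mem_compl_iff, th_kit_pre, Set.mem_union, th_kit_pair hσ h1o h2o h1o h3o,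
          th_kit_pair hσ h1o h2o h1o hbo,
          th_off_rfl h1o ω, true_or, true_and, th_off_comm {o}ᶜ (a₃ : V) (a₂ : V) ω, th_kit_pair_o hσ h1o h2o h1o]
        tauto]
  ring

/-- **Slices of `G₃ = μ(R ∩ {a₁↔o} ∩ {a₃↔b})`** (the `σ_∅` slice vanishes). [cite: KozmaNitzan2024, proof of Thm. 4 (pp. 13–14)] -/
theorem th_exp_G3 (h12 : (a₁ : V) ≠ a₂)
    (hiso : ∀ u, u ≠ o → u ∉ ({(a₁ : V), (a₂ : V)} : Finset V) → w s(o, u) = 0) :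
    (prodBernoulli w).real ((openConn (a₁ : V) (a₃ : V))ᶜ ∩ (openConn (a₁ : V) o ∩ openConn (a₃ : V) (b : V))) =
      (prodBernoulli w).real (starEvent o ({(a₁ : V)} : Set V)) *
        (prodBernoulli (w ∘ Sym2.map (Subtype.val : ({o}ᶜ : Set V) → V))).real ((openConn a₁ a₃)ᶜ ∩ openConn a₃ b) +
      (prodBernoulli w).real (starEvent o ({(a₂ : V)} : Set V)) *
        (prodBernoulli (w ∘ Sym2.map (Subtype.val : ({o}ᶜ : Set V) → V))).real ((openConn a₁ a₃)ᶜ ∩ (openConn a₂ a₁ ∩ openConn a₃ b)) +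
      (prodBernoulli w).real (starEvent o ({(a₁ : V), (a₂ : V)} : Set V)) *
        (prodBernoulli (w ∘ Sym2.map (Subtype.val : ({o}ᶜ : Set V) → V))).real ((openConn a₁ a₃)ᶜ ∩ (openConn a₃ a₂)ᶜ ∩ openConn a₃ b) := by
  have h1o : (a₁ : V) ≠ o := a₁.2
  have h2o : (a₂ : V) ≠ o := a₂.2
  have h3o : (a₃ : V) ≠ o := a₃.2
  have hbo : (b : V) ≠ o := b.2
  rw [th_real_eq_four w h12 h1o.symm h2o.symm hiso]
  rw [th_real_inter_star_zero w o ∅ fun ω hσ hE => by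
        exact th_kit_empty_o hσ h1o hE.2.1,
    th_real_inter_star w o {(a₁ : V)} (E' := (openConn a₁ a₃)ᶜ ∩ openConn a₃ b) fun ω hσ => by
        simp only [Set.mem_inter_iff, Set.mem_compl_iff, th_kit_pre, th_kit_single hσ h1o h3o, th_kit_single hσ h3o hbo, th_kit_single_o hσ h1o h1o, th_off_rfl h1o ω, true_and],
    th_real_inter_star w o {(a₂ : V)} (E' := (openConn a₁ a₃)ᶜ ∩ (openConn a₂ a₁ ∩ openConn a₃ b)) fun ω hσ => by
        simp only [Set.mem_inter_iff, Set.mem_compl_iff, th_kit_pre, th_kit_single hσ h1o h3o, th_kit_single hσ h3o hbo, th_kit_single_o hσ h2o h1o],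
    th_real_inter_star w o {(a₁ : V), (a₂ : V)} (E' := (openConn a₁ a₃)ᶜ ∩ (openConn a₃ a₂)ᶜ ∩ openConn a₃ b) fun ω hσ => by
        simp only [Set.mem_inter_iff, Set.mem_compl_iff, th_kit_pre, th_kit_pair hσ h1o h2o h1o h3o,
          th_kit_pair hσ h1o h2o h3o hbo,
          th_off_rfl h1o ω, true_or, true_and, th_off_comm {o}ᶜ (a₃ : V) (a₂ : V) ω, th_off_comm {o}ᶜ (a₃ : V) (a₁ : V) ω, th_kit_pair_o hσ h1o h2o h1o]
        tauto]
  ring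

/-- **Slices of `μ(N₂)`, `N₂ = {a₂↮a₁} ∩ {a₂↮a₃}`** (the `σ_{a₁,a₂}` slice vanishes). [cite: KozmaNitzan2024, proof of Thm. 4 (pp. 13–14)] -/
theorem th_exp_P2 (h12 : (a₁ : V) ≠ a₂)
    (hiso : ∀ u, u ≠ o → u ∉ ({(a₁ : V), (a₂ : V)} : Finset V) → w s(o, u) = 0) :
    (prodBernoulli w).real ((openConn (a₂ : V) (a₁ : V))ᶜ ∩ (openConn (a₂ : V) (a₃ : V))ᶜ) =
      (prodBernoulli w).real (starEvent o (∅ : Set V)) *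
        (prodBernoulli (w ∘ Sym2.map (Subtype.val : ({o}ᶜ : Set V) → V))).real ((openConn a₂ a₁)ᶜ ∩ (openConn a₂ a₃)ᶜ) +
      (prodBernoulli w).real (starEvent o ({(a₁ : V)} : Set V)) *
        (prodBernoulli (w ∘ Sym2.map (Subtype.val : ({o}ᶜ : Set V) → V))).real ((openConn a₂ a₁)ᶜ ∩ (openConn a₂ a₃)ᶜ) +
      (prodBernoulli w).real (starEvent o ({(a₂ : V)} : Set V)) *
        (prodBernoulli (w ∘ Sym2.map (Subtype.val : ({o}ᶜ : Set V) → V))).real ((openConn a₂ a₁)ᶜ ∩ (openConn a₂ a₃)ᶜ) := by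
  have h1o : (a₁ : V) ≠ o := a₁.2
  have h2o : (a₂ : V) ≠ o := a₂.2
  have h3o : (a₃ : V) ≠ o := a₃.2
  rw [th_real_eq_four w h12 h1o.symm h2o.symm hiso]
  rw [th_real_inter_star w o ∅ (E' := (openConn a₂ a₁)ᶜ ∩ (openConn a₂ a₃)ᶜ) fun ω hσ => by
        simp only [Set.mem_inter_iff, Set.mem_compl_iff, th_kit_pre, th_kit_empty hσ h2o h1o, th_kit_empty hσ h2o h3o],
    th_real_inter_star w o {(a₁ : V)} (E' := (openConn a₂ a₁)ᶜ ∩ (openConn a₂ a₃)ᶜ) fun ω hσ => by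
        simp only [Set.mem_inter_iff, Set.mem_compl_iff, th_kit_pre, th_kit_single hσ h2o h1o, th_kit_single hσ h2o h3o],
    th_real_inter_star w o {(a₂ : V)} (E' := (openConn a₂ a₁)ᶜ ∩ (openConn a₂ a₃)ᶜ) fun ω hσ => by
        simp only [Set.mem_inter_iff, Set.mem_compl_iff, th_kit_pre, th_kit_single hσ h2o h1o, th_kit_single hσ h2o h3o],
    th_real_inter_star_zero w o {(a₁ : V), (a₂ : V)} fun ω hσ hE => by
        simp only [Set.mem_inter_iff, Set.mem_compl_iff, th_kit_pair hσ h1o h2o h2o h1o,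
          th_off_rfl h1o ω, th_off_rfl h2o ω, true_or, or_true, and_self, not_true_eq_false, false_and] at hE]
  ring

/-- **Slices of `μ(N₂ ∩ {a₂↔o})`** (only the `σ_{a₂}` slice survives). [cite: KozmaNitzan2024, proof of Thm. 4 (pp. 13–14)] -/
theorem th_exp_A2 (h12 : (a₁ : V) ≠ a₂)
    (hiso : ∀ u, u ≠ o → u ∉ ({(a₁ : V), (a₂ : V)} : Finset V) → w s(o, u) = 0) :
    (prodBernoulli w).real ((openConn (a₂ : V) (a₁ : V))ᶜ ∩ (openConn (a₂ : V) (a₃ : V))ᶜ ∩ openConn (a₂ : V) o) =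
      (prodBernoulli w).real (starEvent o ({(a₂ : V)} : Set V)) *
        (prodBernoulli (w ∘ Sym2.map (Subtype.val : ({o}ᶜ : Set V) → V))).real ((openConn a₂ a₁)ᶜ ∩ (openConn a₂ a₃)ᶜ) := by
  have h1o : (a₁ : V) ≠ o := a₁.2
  have h2o : (a₂ : V) ≠ o := a₂.2
  have h3o : (a₃ : V) ≠ o := a₃.2
  rw [th_real_eq_four w h12 h1o.symm h2o.symm hiso]
  rw [th_real_inter_star_zero w o ∅ fun ω hσ hE => by
        exact th_kit_empty_o hσ h2o hE.2,
    th_real_inter_star_zero w o {(a₁ : V)} fun ω hσ hE => by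
        simp only [Set.mem_inter_iff, Set.mem_compl_iff, th_kit_single hσ h2o h1o, th_kit_single_o hσ h1o h2o, th_off_comm {o}ᶜ (a₂ : V) (a₁ : V) ω] at hE
        exact hE.1.1 hE.2,
    th_real_inter_star w o {(a₂ : V)} (E' := (openConn a₂ a₁)ᶜ ∩ (openConn a₂ a₃)ᶜ) fun ω hσ => by
        simp only [Set.mem_inter_iff, Set.mem_compl_iff, th_kit_pre, th_kit_single hσ h2o h1o, th_kit_single hσ h2o h3o, th_kit_single_o hσ h2o h2o, th_off_rfl h2o ω, and_true],
    th_real_inter_star_zero w o {(a₁ : V), (a₂ : V)} fun ω hσ hE => by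
        simp only [Set.mem_inter_iff, Set.mem_compl_iff, th_kit_pair hσ h1o h2o h2o h1o,
          th_off_rfl h1o ω, th_off_rfl h2o ω, true_or, or_true, and_self, not_true_eq_false, false_and] at hE]
  ring

end Slices

section Assembly

variable {V : Type*} [Fintype V]

/-- **(Y13) for two-hair observers, general vertex type.**  If the observer `o` has (positive-weight) pairs only
to the sources `a₁, a₂`, then `μ(N₂ ∩ {a₂↔o})·(J₁g₃ − J₃g₁) ≤ μ(N₂)·(G₁g₃ − G₃g₁)` — the registered source/repeller
exchange inequality `stub_sourceRepellerExchangeThreeRelays` of `preFKG3_of_stubSourceRepellerExchange` in this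
sub-case.  Proof: Kozma–Nitzan star integration over `σ_B`, `B ⊆ {a₁,a₂}` (the eight measures are affine in the four
star weights with coefficients measured off `o`), the difference factorises as
`μ'(N₂)·s₁₂·(s_∅+s₁+s₂)·s_∅·Z₀` and `Z₀ ≥ 0` is `th_Z0_nonneg` off `o` (one BHK exchange row).
[cite: KozmaNitzan2024, Lemma 5 and proof of Thm. 4 (pp. 13–14)] [cite: VandenbergHaggstromKahn2005, Thms. 1.3–1.5 (pp. 6–7)] -/
theorem th_y13_twoHair_general (w : Sym2 V → unitInterval) (o : V) (a₁ a₂ a₃ b : ({o}ᶜ : Set V))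
    (h12 : (a₁ : V) ≠ a₂) (h13 : (a₁ : V) ≠ a₃)
    (hiso : ∀ u, u ≠ o → u ∉ ({(a₁ : V), (a₂ : V)} : Finset V) → w s(o, u) = 0) :
    (prodBernoulli w).real ((openConn (a₂ : V) (a₁ : V))ᶜ ∩ (openConn (a₂ : V) (a₃ : V))ᶜ ∩ openConn (a₂ : V) o) *
        ((prodBernoulli w).real ((openConn (a₁ : V) (a₃ : V))ᶜ ∩ (openConn (a₁ : V) (a₂ : V) ∩ openConn (a₁ : V) (b : V))) * (prodBernoulli w).real ((openConn (a₁ : V) (a₃ : V))ᶜ ∩ openConn (a₃ : V) (b : V)) -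
          (prodBernoulli w).real ((openConn (a₁ : V) (a₃ : V))ᶜ ∩ (openConn (a₁ : V) (a₂ : V) ∩ openConn (a₃ : V) (b : V))) * (prodBernoulli w).real ((openConn (a₁ : V) (a₃ : V))ᶜ ∩ openConn (a₁ : V) (b : V))) ≤
      (prodBernoulli w).real ((openConn (a₂ : V) (a₁ : V))ᶜ ∩ (openConn (a₂ : V) (a₃ : V))ᶜ) *
        ((prodBernoulli w).real ((openConn (a₁ : V) (a₃ : V))ᶜ ∩ (openConn (a₁ : V) o ∩ openConn (a₁ : V) (b : V))) * (prodBernoulli w).real ((openConn (a₁ : V) (a₃ : V))ᶜ ∩ openConn (a₃ : V) (b : V)) -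
          (prodBernoulli w).real ((openConn (a₁ : V) (a₃ : V))ᶜ ∩ (openConn (a₁ : V) o ∩ openConn (a₃ : V) (b : V))) * (prodBernoulli w).real ((openConn (a₁ : V) (a₃ : V))ᶜ ∩ openConn (a₁ : V) (b : V))) := by
  have h13' : a₁ ≠ a₃ := fun h => h13 (congrArg Subtype.val h)
  have hZ := th_Z0_nonneg (w ∘ Sym2.map (Subtype.val : ({o}ᶜ : Set V) → V)) b a₁ a₂ a₃ h13'
  rw [th_exp_A2 w o a₁ a₂ a₃ h12 hiso, th_exp_P2 w o a₁ a₂ a₃ h12 hiso, th_exp_g1 w o a₁ a₂ a₃ b h12 hiso,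
    th_exp_g3 w o a₁ a₂ a₃ b h12 hiso, th_exp_J1 w o a₁ a₂ a₃ b h12 hiso, th_exp_J3 w o a₁ a₂ a₃ b h12 hiso,
    th_exp_G1 w o a₁ a₂ a₃ b h12 hiso, th_exp_G3 w o a₁ a₂ a₃ b h12 hiso, openConn_symm a₂ a₁]
  set μ' := prodBernoulli (w ∘ Sym2.map (Subtype.val : ({o}ᶜ : Set V) → V)) with hμ'
  set s0 := (prodBernoulli w).real (starEvent o (∅ : Set V))
  set s1 := (prodBernoulli w).real (starEvent o ({(a₁ : V)} : Set V))
  set s2 := (prodBernoulli w).real (starEvent o ({(a₂ : V)} : Set V))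
  set s12 := (prodBernoulli w).real (starEvent o ({(a₁ : V), (a₂ : V)} : Set V))
  set rb := μ'.real ((openConn a₁ a₃)ᶜ ∩ openConn a₁ b)
  set rt := μ'.real ((openConn a₁ a₃)ᶜ ∩ openConn a₃ b)
  set jb := μ'.real ((openConn a₁ a₃)ᶜ ∩ (openConn a₁ a₂ ∩ openConn a₁ b))
  set jt := μ'.real ((openConn a₁ a₃)ᶜ ∩ (openConn a₁ a₂ ∩ openConn a₃ b))
  set wb := μ'.real ((openConn a₁ a₃)ᶜ ∩ (openConn a₃ a₂)ᶜ ∩ (openConn a₁ b ∪ openConn a₂ b))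
  set wt := μ'.real ((openConn a₁ a₃)ᶜ ∩ (openConn a₃ a₂)ᶜ ∩ openConn a₃ b)
  set n2 := μ'.real ((openConn a₁ a₂)ᶜ ∩ (openConn a₂ a₃)ᶜ)
  have h0 : 0 ≤ s0 := measureReal_nonneg
  have h1 : 0 ≤ s1 := measureReal_nonneg
  have h2 : 0 ≤ s2 := measureReal_nonneg
  have h12' : 0 ≤ s12 := measureReal_nonneg
  have hn2 : 0 ≤ n2 := measureReal_nonneg
  have hc : 0 ≤ n2 * s12 * (s0 + s1 + s2) * s0 := by positivity
  have key := mul_le_mul_of_nonneg_left hZ hc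
  linarith [key]

/-- **(Y13) for two-hair observers** (`Fin n`, the registered stub's shape): for every finite weighted graph in which the
observer `o` is adjacent (with positive weight) only to the sources `a₁, a₂`, the source/repeller exchange inequality
`μ(N₂ ∩ {a₂↔o})·(J₁g₃ − J₃g₁) ≤ μ(N₂)·(G₁g₃ − G₃g₁)` of `stub_sourceRepellerExchangeThreeRelays` holds
(hence, by `preFKG3_of_sourceRepellerExchange`, Kozma–Nitzan's Question 7 at `|A| = 3` for these instances).
[cite: KozmaNitzan2024, Lemma 5, proof of Thm. 4 (pp. 13–14), Question 7 (p. 17)] -/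
theorem y13_twoHair {n : ℕ} (w : Sym2 (Fin n) → unitInterval) (o b a₁ a₂ a₃ : Fin n) (h12 : a₁ ≠ a₂) (h13 : a₁ ≠ a₃)
    (ho1 : o ≠ a₁) (ho2 : o ≠ a₂) (ho3 : o ≠ a₃) (hob : o ≠ b)
    (hiso : ∀ u, u ≠ o → u ∉ ({a₁, a₂} : Finset (Fin n)) → w s(o, u) = 0) :
    (prodBernoulli w).real ((openConn a₂ a₁)ᶜ ∩ (openConn a₂ a₃)ᶜ ∩ openConn a₂ o) *
        ((prodBernoulli w).real ((openConn a₁ a₃)ᶜ ∩ (openConn a₁ a₂ ∩ openConn a₁ b)) *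
            (prodBernoulli w).real ((openConn a₁ a₃)ᶜ ∩ openConn a₃ b) -
          (prodBernoulli w).real ((openConn a₁ a₃)ᶜ ∩ (openConn a₁ a₂ ∩ openConn a₃ b)) *
            (prodBernoulli w).real ((openConn a₁ a₃)ᶜ ∩ openConn a₁ b)) ≤
      (prodBernoulli w).real ((openConn a₂ a₁)ᶜ ∩ (openConn a₂ a₃)ᶜ) *
        ((prodBernoulli w).real ((openConn a₁ a₃)ᶜ ∩ (openConn a₁ o ∩ openConn a₁ b)) *
            (prodBernoulli w).real ((openConn a₁ a₃)ᶜ ∩ openConn a₃ b) -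
          (prodBernoulli w).real ((openConn a₁ a₃)ᶜ ∩ (openConn a₁ o ∩ openConn a₃ b)) *
            (prodBernoulli w).real ((openConn a₁ a₃)ᶜ ∩ openConn a₁ b)) :=
  th_y13_twoHair_general w o ⟨a₁, Set.mem_compl_singleton_iff.2 ho1.symm⟩ ⟨a₂, Set.mem_compl_singleton_iff.2 ho2.symm⟩
    ⟨a₃, Set.mem_compl_singleton_iff.2 ho3.symm⟩ ⟨b, Set.mem_compl_singleton_iff.2 hob.symm⟩ h12 h13
    fun u hu hu' => hiso u hu (by simpa using hu')

end Assembly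

section Corollary

/-- **Kozma–Nitzan Question 7 at `|A| = 3` for two-hair observers**: if `o` carries positive weight only on the
pairs to the two `τ`-stronger sources `a₁, a₂` (`τ(a₃) ≤ τ(a₁), τ(a₂)`, `μ(M) > 0`), then
`P(o ↔ A, a₃ ↔ b) ≤ P(o ↔ A, o ↔ b)` for `A = {a₁,a₂,a₃}`.  From `y13_twoHair` and
`preFKG3_of_sourceRepellerExchange`. [cite: KozmaNitzan2024, Question 7 (p. 17)] -/
theorem preFKG3_twoHair {n : ℕ} (w : Sym2 (Fin n) → unitInterval) (o b a₁ a₂ a₃ : Fin n) (h12 : a₁ ≠ a₂)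
    (h13 : a₁ ≠ a₃) (h23 : a₂ ≠ a₃) (ho1 : o ≠ a₁) (ho2 : o ≠ a₂) (ho3 : o ≠ a₃) (hob : o ≠ b)
    (hiso : ∀ u, u ≠ o → u ∉ ({a₁, a₂} : Finset (Fin n)) → w s(o, u) = 0)
    (hM : 0 < (prodBernoulli w).real
      ((openConn a₁ a₂)ᶜ ∩ (openConn a₁ a₃)ᶜ ∩ (openConn a₂ a₃)ᶜ : Set (BondConfig (Fin n))))
    (hτ₁ : (prodBernoulli w).real (openConn a₃ b) ≤ (prodBernoulli w).real (openConn a₁ b))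
    (hτ₂ : (prodBernoulli w).real (openConn a₃ b) ≤ (prodBernoulli w).real (openConn a₂ b)) :
    (prodBernoulli w).real ((openConn o a₁ ∪ openConn o a₂ ∪ openConn o a₃) ∩ openConn a₃ b) ≤
      (prodBernoulli w).real ((openConn o a₁ ∪ openConn o a₂ ∪ openConn o a₃) ∩ openConn o b) :=
  preFKG3_of_sourceRepellerExchange w o b a₁ a₂ a₃ h12 h13 h23 hM hτ₁ hτ₂
    (y13_twoHair w o b a₁ a₂ a₃ h12 h13 ho1 ho2 ho3 hob hiso)

end Corollary

end

end Summit.CriticalPhenomena.PercolationContinuityZ3.Theorems
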